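import Summits.ResolutionOfSingularities.ResolutionOfSingularities.Theorems.FrobeniusLadderFInjectiveMacaulayficationPencilExitTagW
import HarnessLib

/-!
# TASK 4b SOUNDNESS, the bulk tag (✓p694236 code 1 «pencil j = 0», `M₂|_Z ≤ 1`, not deep): the `W`-chart is FULL at every closed point of the orbit — witness = the `W⁰`-term, read
# after ALSO killing one letter `y_{i₀}` with `M₁ i₀ ≥ 1` (so the `W`-term of `Φ` disappears and the Fedder element becomes `±(β·y^{M₂|_Z}·Θ(χ))^{p−1}`, whose coefficient at
# `y^{(p−1)M₂|_Z}` is a `(p−1)`-st power of the constant term of `Θ(χ)`)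
# (crux `FInjectiveMacaulayfication` stmt-ResolutionOfSingularities-15315, chain w45a; RULING R23.2 (2); consumer res-L1-w45a-stub-3 TASK 4c; seat res-L1-w45a-stub-1 g14)

[OURS · L1 W4.5a] Support file (`--supports stmt-ResolutionOfSingularities-15315 --as helper`); theorems only; unconditional; any field of characteristic `p` (every prime). Nothing of the
crux is proved; no census row is asserted. AI-written (AI review is weaker than expert review).

LETTER as in ✓p696297 (`W = X 0`, base letters `X i.succ`, closed point `(w₀; c)`, orbit `Z = {c = 0}`). HYPOTHESES of `fullCl_pencilChartW_code1`: `M₁, M₂` with disjoint supports;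
`M₂ i ≤ 1` on `Z`; EXACTLY ONE of `r|_Z = 0`, `s|_Z = 0` (= «not deep» ∧ the first two disjuncts of `nonpdiv` in `exitOK`; the two-unit transversal case `r|_Z = s|_Z = 0` is NOT covered
here); `Φ` prime. If moreover `M₁|_Z ≤ 1` the claim is ✓p696297; otherwise some `i₀ ∈ Z` has `M₁ i₀ ≥ 1` and the substitution `Θ : W ↦ W + w₀, y_i ↦ c_i (i ∉ Z), y_{i₀} ↦ 0,
y_i ↦ y_i (i ∈ Z ∖ i₀)` kills `y^{M₁}` and maps `Φ` to `−β·y^{M₂|_Z}·(ρ·Θ(y^{r}) − σ·Θ(y^{s}))`, one of `Θ(y^r), Θ(y^s)` a non-zero constant and the other without constant term; so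
`y^{(p−1)M₂|_Z}` is in the support of `Θ(Φ)^{p−1}` (constant coefficients are multiplicative) and ✓p695452 `hypersurface_fullCl_stalk_of_reduction` concludes.
* §1 `kill_monomial`, `constantCoeff_kill_monomial`, `coeff_cons_zero_rename_succ`; §2 ★★ `fullCl_pencilChartW_code1`; §3 ★★ `fullCl_pencilChartU_pole_code1` (the pole `U = 0`).
[cite: Fedder1983, Thm. 1.12]
-/

set_option linter.dupNamespace false

noncomputable section

open AlgebraicGeometry IsLocalRing MvPolynomial
open scoped Pointwise

namespace Summit.ResolutionOfSingularities.ResolutionOfSingularities.Theorems.FInjectiveMacaulayfication.PencilExitTagCode1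

open Summit.ResolutionOfSingularities.ResolutionOfSingularities.Theorems.FInjectiveMacaulayfication
open SliceableCentre PencilExitTagW

variable (k : Type) [Field k] {n : ℕ}

/-! ## §1 Killing one letter -/

/-- **Killing the letter `y_{i₀}` on a monomial**: `y^m ↦ y^m` if `m i₀ = 0`, `↦ 0` otherwise. [plumbing] -/
theorem kill_monomial (i₀ : Fin n) (m : Fin n →₀ ℕ) :
    aeval (fun i : Fin n => if i = i₀ then (0 : MvPolynomial (Fin n) k) else X i) (monomial m (1 : k)) = if m i₀ = 0 then monomial m 1 else 0 := by
  classical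
  rw [aeval_monomial, map_one, one_mul]
  split_ifs with h
  · rw [monomial_eq, C_1, one_mul, Finsupp.prod, Finsupp.prod]
    refine Finset.prod_congr rfl fun i hi => ?_
    have hi0 : i ≠ i₀ := by rintro rfl; exact (Finsupp.mem_support_iff.1 hi) h
    rw [if_neg hi0]
  · rw [Finsupp.prod, Finset.prod_eq_zero (i := i₀) (Finsupp.mem_support_iff.2 h)]
    rw [if_pos rfl, zero_pow h]

/-- Constant term after killing: `1` iff `m = 0`. [plumbing] -/
theorem constantCoeff_kill_monomial (i₀ : Fin n) (m : Fin n →₀ ℕ) :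
    constantCoeff (aeval (fun i : Fin n => if i = i₀ then (0 : MvPolynomial (Fin n) k) else X i) (monomial m (1 : k))) = if m = 0 then 1 else 0 := by
  classical
  rw [kill_monomial]
  split_ifs with h1 h2 h2
  · rw [h2, constantCoeff_monomial, if_pos rfl]
  · rw [constantCoeff_monomial, if_neg h2]
  · exact absurd (by rw [h2]; rfl) h1
  · rw [map_zero]

/-- The coefficient of `y^{d}` (no `W`) in `q⁺ = rename Fin.succ q` is the coefficient of `y^d` in `q`. [plumbing] -/
theorem coeff_cons_zero_rename_succ (q : MvPolynomial (Fin n) k) (d : Fin n →₀ ℕ) :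
    coeff (Finsupp.cons 0 d) (rename Fin.succ q) = coeff d q := by
  rw [← finSuccEquiv_coeff_coeff, PencilIntegral.finSuccEquiv_rename_succ, Polynomial.coeff_C_zero]

/-! ## §2 ★★ Code 1 -/

set_option maxHeartbeats 1600000 in
-- one long polynomial bookkeeping proof
/-- ★★ **CODE 1 («pencil, j = 0»): the `W`-chart `V(Φ_W)`, `Φ_W = (y^{M₁})⁺·W − (y^{M₂}(y^r − y^s))⁺`, is FULL at every closed point `(w₀; c)` with `M₂ i ≤ 1` on `Z = {c = 0}`, when
EXACTLY ONE of `y^r`, `y^s` is a unit along `Z`** (`M₁ ⊥ M₂`; every prime `p`; `Φ_W` prime a hypothesis, see `PencilPhiPrime`). [OURS · TASK 4b soundness; cite: Fedder1983, Thm. 1.12] -/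
theorem fullCl_pencilChartW_code1 (p : ℕ) [Fact p.Prime] [CharP k p] (M₁ M₂ r s : Fin n →₀ ℕ) (hdisj : ∀ i, M₁ i = 0 ∨ M₂ i = 0)
    (Φ : MvPolynomial (Fin (n + 1)) k)
    (hΦ : Φ = rename Fin.succ (monomial M₁ (1 : k)) * X 0 - rename Fin.succ (monomial M₂ (1 : k) * (monomial r 1 - monomial s 1))) (hΦp : Prime Φ)
    (c : Fin n → k) (w₀ : k) (y : Spec (.of (MvPolynomial (Fin (n + 1)) k ⧸ Ideal.span {Φ}))) (hy : y.asIdeal.IsMaximal)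
    (ha : y.asIdeal.comap (Ideal.Quotient.mk (Ideal.span {Φ})) =
      Ideal.span (Set.range (Fin.cons ((X 0 : MvPolynomial (Fin (n + 1)) k) - C w₀) fun i : Fin n => X i.succ - C (c i))))
    (hM₂ : ∀ i, c i = 0 → M₂ i ≤ 1)
    (hunit : (∀ i, c i = 0 → r i = 0) ↔ ¬ (∀ i, c i = 0 → s i = 0)) :
    FullCl p ((Spec (.of (MvPolynomial (Fin (n + 1)) k ⧸ Ideal.span {Φ}))).presheaf.stalk y) := by
  classical
  -- if `M₁|_Z ≤ 1` this is the `W^{p−1}` witness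
  by_cases hM₁ : ∀ i, c i = 0 → M₁ i ≤ 1
  · exact fullCl_pencilChartW_of_M₁_le_one k p M₁ _ Φ hΦ hΦp c w₀ y hy ha hM₁
  push Not at hM₁
  obtain ⟨i₀, hci₀, hM₁i₀⟩ := hM₁
  have hM₁i₀' : M₁ i₀ ≠ 0 := by omega
  have hM₂i₀ : M₂ i₀ = 0 := (hdisj i₀).resolve_left hM₁i₀'
  have hp1 : 1 ≤ p := (Fact.out : p.Prime).one_lt.le
  -- the substitutions
  set v₀ : Fin n → MvPolynomial (Fin n) k := fun i => if c i = 0 then X i else C (c i) with hv₀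
  set θ₀ : MvPolynomial (Fin n) k →ₐ[k] MvPolynomial (Fin n) k := aeval v₀ with hθ₀
  set π : MvPolynomial (Fin n) k →ₐ[k] MvPolynomial (Fin n) k := aeval (fun i : Fin n => if i = i₀ then (0 : MvPolynomial (Fin n) k) else X i) with hπ
  set Θ : MvPolynomial (Fin (n + 1)) k →ₐ[k] MvPolynomial (Fin (n + 1)) k :=
    aeval (Fin.cons (X 0 + C w₀) fun i : Fin n => rename Fin.succ (π (v₀ i))) with hΘ
  have hΘX0 : Θ (X 0) = X 0 + C w₀ := by rw [hΘ, aeval_X, Fin.cons_zero]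
  have hΘsucc : ∀ q : MvPolynomial (Fin n) k, Θ (rename Fin.succ q) = rename Fin.succ (π (θ₀ q)) := by
    intro q
    rw [hΘ, aeval_rename, hθ₀, ← AlgHom.comp_apply, ← AlgHom.comp_apply]
    congr 1
    refine MvPolynomial.algHom_ext fun i => ?_
    rw [AlgHom.comp_apply, AlgHom.comp_apply, aeval_X, aeval_X, Function.comp_apply, Fin.cons_succ]
  -- `θ₀` and `π` on the three monomials
  have hθ₀m : ∀ M : Fin n →₀ ℕ, θ₀ (monomial M 1) = C (∏ i ∈ M.support with c i ≠ 0, c i ^ M i) * monomial (M.filter fun i => c i = 0) 1 := fun M => by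
    rw [hθ₀, hv₀, theta0_monomial]
  have hπA : π (θ₀ (monomial M₁ 1)) = 0 := by
    rw [hθ₀m, map_mul, hπ, kill_monomial, if_neg (by rw [Finsupp.filter_apply_pos (fun i => c i = 0) M₁ hci₀]; exact hM₁i₀'), mul_zero]
  have hπM₂ : π (monomial (M₂.filter fun i => c i = 0) (1 : k)) = monomial (M₂.filter fun i => c i = 0) 1 := by
    rw [hπ, kill_monomial, if_pos (by rw [Finsupp.filter_apply_pos (fun i => c i = 0) M₂ hci₀]; exact hM₂i₀)]
  set β : k := ∏ i ∈ M₂.support with c i ≠ 0, c i ^ M₂ i with hβ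
  set ρ : k := ∏ i ∈ r.support with c i ≠ 0, c i ^ r i with hρ
  set σ : k := ∏ i ∈ s.support with c i ≠ 0, c i ^ s i with hσ
  have hβ0 : β ≠ 0 := theta0_scalar_ne_zero k c M₂
  have hρ0 : ρ ≠ 0 := theta0_scalar_ne_zero k c r
  have hσ0 : σ ≠ 0 := theta0_scalar_ne_zero k c s
  set ψ : MvPolynomial (Fin n) k := C ρ * π (monomial (r.filter fun i => c i = 0) 1) - C σ * π (monomial (s.filter fun i => c i = 0) 1) with hψ
  have hΘB : π (θ₀ (monomial M₂ (1 : k) * (monomial r 1 - monomial s 1))) = C β * monomial (M₂.filter fun i => c i = 0) 1 * ψ := by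
    rw [map_mul, map_sub, hθ₀m, hθ₀m, hθ₀m, map_mul, map_sub, map_mul, map_mul, map_mul, hπM₂, hψ, hπ, aeval_C, aeval_C, aeval_C, algebraMap_eq]
  have hΘΦ : Θ Φ = rename Fin.succ (-(C β * monomial (M₂.filter fun i => c i = 0) 1 * ψ)) := by
    rw [hΦ, map_sub, map_mul, hΘsucc, hΘsucc, hπA, map_zero, zero_mul, zero_sub, hΘB, map_neg]
  -- the constant term of `ψ`
  have hψ0 : constantCoeff ψ ≠ 0 := by
    have hr0 : ((r.filter fun i => c i = 0) = 0) ↔ ∀ i, c i = 0 → r i = 0 := by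
      constructor
      · intro h i hci; have := DFunLike.congr_fun h i; rwa [Finsupp.filter_apply_pos (fun i => c i = 0) r hci] at this
      · intro h; ext i; by_cases hci : c i = 0
        · rw [Finsupp.filter_apply_pos (fun i => c i = 0) r hci, h i hci]; rfl
        · rw [Finsupp.filter_apply_neg (fun i => c i = 0) r hci]; rfl
    have hs0 : ((s.filter fun i => c i = 0) = 0) ↔ ∀ i, c i = 0 → s i = 0 := by
      constructor
      · intro h i hci; have := DFunLike.congr_fun h i; rwa [Finsupp.filter_apply_pos (fun i => c i = 0) s hci] at this
      · intro h; ext i; by_cases hci : c i = 0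
        · rw [Finsupp.filter_apply_pos (fun i => c i = 0) s hci, h i hci]; rfl
        · rw [Finsupp.filter_apply_neg (fun i => c i = 0) s hci]; rfl
    rw [hψ, map_sub, map_mul, map_mul, constantCoeff_C, constantCoeff_C, hπ, constantCoeff_kill_monomial, constantCoeff_kill_monomial]
    by_cases hr : ∀ i, c i = 0 → r i = 0
    · have hs : ¬ ∀ i, c i = 0 → s i = 0 := hunit.1 hr
      rw [if_pos (hr0.2 hr), if_neg (fun h => hs (hs0.1 h)), mul_one, mul_zero, sub_zero]; exact hρ0
    · have hs : ∀ i, c i = 0 → s i = 0 := by by_contra h; exact hr (hunit.2 h)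
      rw [if_neg (fun h => hr (hr0.1 h)), if_pos (hs0.2 hs), mul_zero, mul_one, zero_sub]; exact neg_ne_zero.2 hσ0
  -- the witness monomial `y^{(p−1) M₂|_Z}` (no `W`)
  set d₀ : Fin n →₀ ℕ := (p - 1) • M₂.filter fun i => c i = 0 with hd₀
  have hcoeff : coeff (Finsupp.cons 0 d₀) (Θ Φ ^ (p - 1)) = (-1) ^ (p - 1) * β ^ (p - 1) * constantCoeff ψ ^ (p - 1) := by
    rw [hΘΦ, ← map_pow, coeff_cons_zero_rename_succ, neg_pow, mul_pow, mul_pow, ← map_pow, monomial_pow, one_pow, ← hd₀,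
      show ((-1 : MvPolynomial (Fin n) k) ^ (p - 1)) = C ((-1 : k) ^ (p - 1)) by rw [map_pow, map_neg, map_one], ← mul_assoc, ← mul_assoc, ← map_mul, mul_assoc, coeff_C_mul,
      coeff_monomial_mul', if_pos le_rfl, tsub_self, one_mul, ← constantCoeff_eq, map_pow, mul_assoc]
  have hd : Finsupp.cons 0 d₀ ∈ ((Θ : MvPolynomial (Fin (n + 1)) k →+* MvPolynomial (Fin (n + 1)) k) Φ ^ (p - 1)).support := by
    rw [mem_support_iff, RingHom.coe_coe, hcoeff]
    exact mul_ne_zero (mul_ne_zero (pow_ne_zero _ (neg_ne_zero.2 one_ne_zero)) (pow_ne_zero _ hβ0)) (pow_ne_zero _ hψ0)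
  -- conclude by the reduction
  refine PencilExitSoundnessKit.hypersurface_fullCl_stalk_of_reduction k p Φ hΦp _ y hy ha (Θ : MvPolynomial (Fin (n + 1)) k →+* MvPolynomial (Fin (n + 1)) k)
    ({0} ∪ Set.range fun i : {i : Fin n // c i = 0} => (i.1.succ : Fin (n + 1))) (fun j => ?_) _ hd (fun j hj => ?_)
  · refine Fin.cases ?_ (fun i => ?_) j
    · right
      refine ⟨0, Set.mem_union_left _ rfl, ?_⟩
      rw [Fin.cons_zero, RingHom.coe_coe, map_sub, hΘX0, hΘ, aeval_C, algebraMap_eq]; ring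
    · have hΘi : Θ (X i.succ) = rename Fin.succ (π (v₀ i)) := by rw [hΘ, aeval_X, Fin.cons_succ]
      by_cases hci : c i = 0
      · by_cases hii : i = i₀
        · left
          rw [Fin.cons_succ, RingHom.coe_coe, map_sub, hΘi, hv₀]; dsimp only
          rw [if_pos hci, hπ, aeval_X, if_pos hii, map_zero, hΘ, aeval_C, algebraMap_eq, hci, C_0, sub_zero]
        · right
          refine ⟨i.succ, Set.mem_union_right _ ⟨⟨i, hci⟩, rfl⟩, ?_⟩
          rw [Fin.cons_succ, RingHom.coe_coe, map_sub, hΘi, hv₀]; dsimp only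
          rw [if_pos hci, hπ, aeval_X, if_neg hii, rename_X, hΘ, aeval_C, algebraMap_eq, hci, C_0, sub_zero]
      · left
        rw [Fin.cons_succ, RingHom.coe_coe, map_sub, hΘi, hv₀]; dsimp only
        rw [if_neg hci, hπ, aeval_C, algebraMap_eq, rename_C, hΘ, aeval_C, algebraMap_eq, sub_self]
  · rcases hj with hj | ⟨⟨i, hci⟩, rfl⟩
    · rw [Set.mem_singleton_iff] at hj; subst hj
      rw [Finsupp.cons_zero]; omega
    · rw [Finsupp.cons_succ, hd₀, Finsupp.smul_apply, Finsupp.filter_apply_pos (fun i => c i = 0) M₂ hci, smul_eq_mul]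
      have := hM₂ i hci
      calc (p - 1) * M₂ i ≤ (p - 1) * 1 := Nat.mul_le_mul_left _ this
        _ < p := by omega

/-! ## §3 ★★ Code 1 at the pole `U = 0` -/

set_option maxHeartbeats 1600000 in
-- one long polynomial bookkeeping proof
/-- ★★ **CODE 1 AT THE POLE**: the `U`-chart `V(Φ_U)`, `Φ_U = (y^{M₂}(y^r − y^s))⁺·U − (y^{M₁})⁺`, is FULL at every closed point `(0; c)` of `U = 0` under the code-1 hypotheses (`M₂ i ≤ 1` on
`Z`, exactly one of `y^r`, `y^s` a unit along `Z`, `M₁ ⊥ M₂`; every prime `p`). Witness: after killing a letter `y_{i₀}` with `M₁ i₀ ≥ 1`, `Θ(Φ_U) = (β·y^{M₂|_Z}·ψ)⁺·U` and the monomial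
`U^{p−1}·y^{(p−1)M₂|_Z}`; if `M₁|_Z ≤ 1`, ✓p696598 `fullCl_pencilChartU_pole_of_M₁_le_one`. [OURS · TASK 4b soundness; cite: Fedder1983, Thm. 1.12] -/
theorem fullCl_pencilChartU_pole_code1 (p : ℕ) [Fact p.Prime] [CharP k p] (M₁ M₂ r s : Fin n →₀ ℕ) (hdisj : ∀ i, M₁ i = 0 ∨ M₂ i = 0)
    (Φ : MvPolynomial (Fin (n + 1)) k)
    (hΦ : Φ = rename Fin.succ (monomial M₂ (1 : k) * (monomial r 1 - monomial s 1)) * X 0 - rename Fin.succ (monomial M₁ (1 : k))) (hΦp : Prime Φ)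
    (c : Fin n → k) (y : Spec (.of (MvPolynomial (Fin (n + 1)) k ⧸ Ideal.span {Φ}))) (hy : y.asIdeal.IsMaximal)
    (ha : y.asIdeal.comap (Ideal.Quotient.mk (Ideal.span {Φ})) =
      Ideal.span (Set.range (Fin.cons (X 0 : MvPolynomial (Fin (n + 1)) k) fun i : Fin n => X i.succ - C (c i))))
    (hM₂ : ∀ i, c i = 0 → M₂ i ≤ 1)
    (hunit : (∀ i, c i = 0 → r i = 0) ↔ ¬ (∀ i, c i = 0 → s i = 0)) :
    FullCl p ((Spec (.of (MvPolynomial (Fin (n + 1)) k ⧸ Ideal.span {Φ}))).presheaf.stalk y) := by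
  classical
  by_cases hM₁ : ∀ i, c i = 0 → M₁ i ≤ 1
  · exact fullCl_pencilChartU_pole_of_M₁_le_one k p M₁ _ Φ hΦ hΦp c y hy ha hM₁
  push Not at hM₁
  obtain ⟨i₀, hci₀, hM₁i₀⟩ := hM₁
  have hM₁i₀' : M₁ i₀ ≠ 0 := by omega
  have hM₂i₀ : M₂ i₀ = 0 := (hdisj i₀).resolve_left hM₁i₀'
  have hp1 : 1 ≤ p := (Fact.out : p.Prime).one_lt.le
  -- the substitutions (no shift of `U`)
  set v₀ : Fin n → MvPolynomial (Fin n) k := fun i => if c i = 0 then X i else C (c i) with hv₀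
  set θ₀ : MvPolynomial (Fin n) k →ₐ[k] MvPolynomial (Fin n) k := aeval v₀ with hθ₀
  set π : MvPolynomial (Fin n) k →ₐ[k] MvPolynomial (Fin n) k := aeval (fun i : Fin n => if i = i₀ then (0 : MvPolynomial (Fin n) k) else X i) with hπ
  set Θ : MvPolynomial (Fin (n + 1)) k →ₐ[k] MvPolynomial (Fin (n + 1)) k :=
    aeval (Fin.cons (X 0) fun i : Fin n => rename Fin.succ (π (v₀ i))) with hΘ
  have hΘX0 : Θ (X 0) = X 0 := by rw [hΘ, aeval_X, Fin.cons_zero]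
  have hΘsucc : ∀ q : MvPolynomial (Fin n) k, Θ (rename Fin.succ q) = rename Fin.succ (π (θ₀ q)) := by
    intro q
    rw [hΘ, aeval_rename, hθ₀, ← AlgHom.comp_apply, ← AlgHom.comp_apply]
    congr 1
    refine MvPolynomial.algHom_ext fun i => ?_
    rw [AlgHom.comp_apply, AlgHom.comp_apply, aeval_X, aeval_X, Function.comp_apply, Fin.cons_succ]
  have hθ₀m : ∀ M : Fin n →₀ ℕ, θ₀ (monomial M 1) = C (∏ i ∈ M.support with c i ≠ 0, c i ^ M i) * monomial (M.filter fun i => c i = 0) 1 := fun M => by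
    rw [hθ₀, hv₀, theta0_monomial]
  have hπA : π (θ₀ (monomial M₁ 1)) = 0 := by
    rw [hθ₀m, map_mul, hπ, kill_monomial, if_neg (by rw [Finsupp.filter_apply_pos (fun i => c i = 0) M₁ hci₀]; exact hM₁i₀'), mul_zero]
  have hπM₂ : π (monomial (M₂.filter fun i => c i = 0) (1 : k)) = monomial (M₂.filter fun i => c i = 0) 1 := by
    rw [hπ, kill_monomial, if_pos (by rw [Finsupp.filter_apply_pos (fun i => c i = 0) M₂ hci₀]; exact hM₂i₀)]
  set β : k := ∏ i ∈ M₂.support with c i ≠ 0, c i ^ M₂ i with hβ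
  set ρ : k := ∏ i ∈ r.support with c i ≠ 0, c i ^ r i with hρ
  set σ : k := ∏ i ∈ s.support with c i ≠ 0, c i ^ s i with hσ
  have hβ0 : β ≠ 0 := theta0_scalar_ne_zero k c M₂
  have hρ0 : ρ ≠ 0 := theta0_scalar_ne_zero k c r
  have hσ0 : σ ≠ 0 := theta0_scalar_ne_zero k c s
  set ψ : MvPolynomial (Fin n) k := C ρ * π (monomial (r.filter fun i => c i = 0) 1) - C σ * π (monomial (s.filter fun i => c i = 0) 1) with hψ
  have hΘB : π (θ₀ (monomial M₂ (1 : k) * (monomial r 1 - monomial s 1))) = C β * monomial (M₂.filter fun i => c i = 0) 1 * ψ := by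
    rw [map_mul, map_sub, hθ₀m, hθ₀m, hθ₀m, map_mul, map_sub, map_mul, map_mul, map_mul, hπM₂, hψ, hπ, aeval_C, aeval_C, aeval_C, algebraMap_eq]
  have hΘΦ : Θ Φ = rename Fin.succ (C β * monomial (M₂.filter fun i => c i = 0) 1 * ψ) * X 0 := by
    rw [hΦ, map_sub, map_mul, hΘsucc, hΘsucc, hπA, hΘB, hΘX0, map_zero, sub_zero]
  -- the constant term of `ψ`
  have hψ0 : constantCoeff ψ ≠ 0 := by
    have hr0 : ((r.filter fun i => c i = 0) = 0) ↔ ∀ i, c i = 0 → r i = 0 := by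
      constructor
      · intro h i hci; have := DFunLike.congr_fun h i; rwa [Finsupp.filter_apply_pos (fun i => c i = 0) r hci] at this
      · intro h; ext i; by_cases hci : c i = 0
        · rw [Finsupp.filter_apply_pos (fun i => c i = 0) r hci, h i hci]; rfl
        · rw [Finsupp.filter_apply_neg (fun i => c i = 0) r hci]; rfl
    have hs0 : ((s.filter fun i => c i = 0) = 0) ↔ ∀ i, c i = 0 → s i = 0 := by
      constructor
      · intro h i hci; have := DFunLike.congr_fun h i; rwa [Finsupp.filter_apply_pos (fun i => c i = 0) s hci] at this
      · intro h; ext i; by_cases hci : c i = 0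
        · rw [Finsupp.filter_apply_pos (fun i => c i = 0) s hci, h i hci]; rfl
        · rw [Finsupp.filter_apply_neg (fun i => c i = 0) s hci]; rfl
    rw [hψ, map_sub, map_mul, map_mul, constantCoeff_C, constantCoeff_C, hπ, constantCoeff_kill_monomial, constantCoeff_kill_monomial]
    by_cases hr : ∀ i, c i = 0 → r i = 0
    · have hs : ¬ ∀ i, c i = 0 → s i = 0 := hunit.1 hr
      rw [if_pos (hr0.2 hr), if_neg (fun h => hs (hs0.1 h)), mul_one, mul_zero, sub_zero]; exact hρ0
    · have hs : ∀ i, c i = 0 → s i = 0 := by by_contra h; exact hr (hunit.2 h)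
      rw [if_neg (fun h => hr (hr0.1 h)), if_pos (hs0.2 hs), mul_zero, mul_one, zero_sub]; exact neg_ne_zero.2 hσ0
  -- in `k[y][U]`: the `U^{p−1}` coefficient
  have hfs : finSuccEquiv k n (Θ Φ) = Polynomial.C (C β * monomial (M₂.filter fun i => c i = 0) 1 * ψ) * Polynomial.X + Polynomial.C 0 := by
    rw [hΘΦ, map_mul, PencilIntegral.finSuccEquiv_rename_succ, finSuccEquiv_X_zero, map_zero, add_zero]
  have hq0 : (C β * monomial (M₂.filter fun i => c i = 0) (1 : k) * ψ) ≠ 0 := by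
    refine mul_ne_zero (mul_ne_zero (by rwa [Ne, C_eq_zero]) (by rw [Ne, monomial_eq_zero]; exact one_ne_zero)) fun h => hψ0 ?_
    rw [h, map_zero]
  have hlead : ((finSuccEquiv k n (Θ Φ)) ^ (p - 1)).coeff (p - 1) = (C β * monomial (M₂.filter fun i => c i = 0) (1 : k) * ψ) ^ (p - 1) := by
    rw [hfs]
    have hdeg := Polynomial.natDegree_linear (b := (0 : MvPolynomial (Fin n) k)) hq0
    have hlc := Polynomial.leadingCoeff_linear (b := (0 : MvPolynomial (Fin n) k)) hq0
    have h1 : ((Polynomial.C (C β * monomial (M₂.filter fun i => c i = 0) (1 : k) * ψ) * Polynomial.X + Polynomial.C 0) ^ (p - 1)).natDegree = p - 1 := by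
      rw [Polynomial.natDegree_pow, hdeg, mul_one]
    have h2 := Polynomial.coeff_natDegree (p := (Polynomial.C (C β * monomial (M₂.filter fun i => c i = 0) (1 : k) * ψ) * Polynomial.X + Polynomial.C 0) ^ (p - 1))
    rw [h1] at h2
    rw [h2, Polynomial.leadingCoeff_pow, hlc]
  set d₀ : Fin n →₀ ℕ := (p - 1) • M₂.filter fun i => c i = 0 with hd₀
  have hcoeff : coeff (Finsupp.cons (p - 1) d₀) (Θ Φ ^ (p - 1)) = β ^ (p - 1) * constantCoeff ψ ^ (p - 1) := by
    rw [← finSuccEquiv_coeff_coeff, map_pow, hlead, mul_pow, mul_pow, ← map_pow, monomial_pow, one_pow, ← hd₀, mul_assoc, coeff_C_mul,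
      coeff_monomial_mul', if_pos le_rfl, tsub_self, one_mul, ← constantCoeff_eq, map_pow]
  have hd : Finsupp.cons (p - 1) d₀ ∈ ((Θ : MvPolynomial (Fin (n + 1)) k →+* MvPolynomial (Fin (n + 1)) k) Φ ^ (p - 1)).support := by
    rw [mem_support_iff, RingHom.coe_coe, hcoeff]
    exact mul_ne_zero (pow_ne_zero _ hβ0) (pow_ne_zero _ hψ0)
  refine PencilExitSoundnessKit.hypersurface_fullCl_stalk_of_reduction k p Φ hΦp _ y hy ha (Θ : MvPolynomial (Fin (n + 1)) k →+* MvPolynomial (Fin (n + 1)) k)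
    ({0} ∪ Set.range fun i : {i : Fin n // c i = 0} => (i.1.succ : Fin (n + 1))) (fun j => ?_) _ hd (fun j hj => ?_)
  · refine Fin.cases ?_ (fun i => ?_) j
    · right
      exact ⟨0, Set.mem_union_left _ rfl, by rw [Fin.cons_zero, RingHom.coe_coe, hΘX0]⟩
    · have hΘi : Θ (X i.succ) = rename Fin.succ (π (v₀ i)) := by rw [hΘ, aeval_X, Fin.cons_succ]
      by_cases hci : c i = 0
      · by_cases hii : i = i₀
        · left
          rw [Fin.cons_succ, RingHom.coe_coe, map_sub, hΘi, hv₀]; dsimp only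
          rw [if_pos hci, hπ, aeval_X, if_pos hii, map_zero, hΘ, aeval_C, algebraMap_eq, hci, C_0, sub_zero]
        · right
          refine ⟨i.succ, Set.mem_union_right _ ⟨⟨i, hci⟩, rfl⟩, ?_⟩
          rw [Fin.cons_succ, RingHom.coe_coe, map_sub, hΘi, hv₀]; dsimp only
          rw [if_pos hci, hπ, aeval_X, if_neg hii, rename_X, hΘ, aeval_C, algebraMap_eq, hci, C_0, sub_zero]
      · left
        rw [Fin.cons_succ, RingHom.coe_coe, map_sub, hΘi, hv₀]; dsimp only
        rw [if_neg hci, hπ, aeval_C, algebraMap_eq, rename_C, hΘ, aeval_C, algebraMap_eq, sub_self]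
  · rcases hj with hj | ⟨⟨i, hci⟩, rfl⟩
    · rw [Set.mem_singleton_iff] at hj; subst hj
      rw [Finsupp.cons_zero]; omega
    · rw [Finsupp.cons_succ, hd₀, Finsupp.smul_apply, Finsupp.filter_apply_pos (fun i => c i = 0) M₂ hci, smul_eq_mul]
      have := hM₂ i hci
      calc (p - 1) * M₂ i ≤ (p - 1) * 1 := Nat.mul_le_mul_left _ this
        _ < p := by omega

end Summit.ResolutionOfSingularities.ResolutionOfSingularities.Theorems.FInjectiveMacaulayfication.PencilExitTagCode1

end
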